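import Mathlib
import HarnessLib

/-!
# [OURS · L1 W4.5(b) · EL♮(3) · door ν4, brick N-0, route (B) of the remaining cores W5/S8] `Proj` OF A GRADED ISOMORPHISM IS AN ISOMORPHISM —
# ★ `ProjMapIso.isIso_projMap_of_inverse` (Mathlib `Proj.map_comp` / `Proj.map_id`)

res-L1-w45b-nose-w1 g4 (WIDTH seat D-0157 DOOR 1; N-0 owner).  DEF-FREE; no `sorry`; standard axioms; `import Mathlib`.  `--supports
stmt-ResolutionOfSingularities-20148 --as helper`, counted 0.

WHY.  The remaining cores of N-0 (`cores` of ✓ `coreS_of_cores₂`: regular off the sections, `SplitNodeAt`) are stalk statements at points of the basic open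
`D₊(M)` of a LINEAR form `M` on `ℙ³_O`; route (B) of `HANDOFF-g4.md` transports them to a standard chart `D₊(x_d)` along the projective linear automorphism
`Proj α`, `α(x_d) = M`.  This file supplies the functorial fact: mutually inverse graded ring homomorphisms give mutually inverse `Proj.map`s, hence an
isomorphism of schemes.  EL♮(3) is NOT proved; resolution in positive characteristic is NOT proved.
-/

set_option linter.dupNamespace false -- mandated namespace `Summit.<Summit>.<Problem>` of this single-conjunct summit

noncomputable section

open CategoryTheory AlgebraicGeometry

namespace Summit.ResolutionOfSingularities.ResolutionOfSingularities.Cruxes.EquisingularLiftNat.Sections.Equinodal.ProjMapIso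

universe u

variable {A B : Type u} [CommRing A] [CommRing B] {σ τ : Type u} [SetLike σ A] [AddSubgroupClass σ A] [SetLike τ B] [AddSubgroupClass τ B]
  {𝒜 : ℕ → σ} {ℬ : ℕ → τ} [GradedRing 𝒜] [GradedRing ℬ]
  (f : 𝒜 →+*ᵍ ℬ) (g : ℬ →+*ᵍ 𝒜)

/-- `Proj g ≫ Proj f = 𝟙` when `g ∘ f = id` (contravariance of `Proj.map`). [folklore] -/
theorem projMap_comp_projMap_eq_id (hf : HomogeneousIdeal.irrelevant ℬ ≤ (HomogeneousIdeal.irrelevant 𝒜).map f)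
    (hg : HomogeneousIdeal.irrelevant 𝒜 ≤ (HomogeneousIdeal.irrelevant ℬ).map g) (hgf : g.comp f = GradedRingHom.id 𝒜) :
    Proj.map g hg ≫ Proj.map f hf = 𝟙 (Proj 𝒜) := by
  rw [← Proj.map_comp f g hf hg]
  have h : ∀ (φ : 𝒜 →+*ᵍ 𝒜) (hφ : HomogeneousIdeal.irrelevant 𝒜 ≤ (HomogeneousIdeal.irrelevant 𝒜).map φ),
      φ = GradedRingHom.id 𝒜 → Proj.map φ hφ = 𝟙 (Proj 𝒜) := by
    rintro φ hφ rfl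
    exact Proj.map_id
  exact h _ _ hgf

/-- ★ **`Proj` of a graded isomorphism is an isomorphism**: if `g ∘ f = id` and `f ∘ g = id` then `Proj.map f` is an isomorphism (with inverse `Proj.map g`).
[folklore] -/
theorem isIso_projMap_of_inverse (hf : HomogeneousIdeal.irrelevant ℬ ≤ (HomogeneousIdeal.irrelevant 𝒜).map f)
    (hg : HomogeneousIdeal.irrelevant 𝒜 ≤ (HomogeneousIdeal.irrelevant ℬ).map g) (hgf : g.comp f = GradedRingHom.id 𝒜)
    (hfg : f.comp g = GradedRingHom.id ℬ) : IsIso (Proj.map f hf) :=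
  ⟨⟨Proj.map g hg, projMap_comp_projMap_eq_id g f hg hf hfg, projMap_comp_projMap_eq_id f g hf hg hgf⟩⟩

end Summit.ResolutionOfSingularities.ResolutionOfSingularities.Cruxes.EquisingularLiftNat.Sections.Equinodal.ProjMapIso

end
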